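import Summits.BirchSwinnertonDyer.Rank1Residual.AdditivePotMult.PotMultBranchPAdicGrossZagier
import Summits.BirchSwinnertonDyer.Rank1Residual.AdditivePotMult.PotMultCycLowerBoundClass
import Summits.BirchSwinnertonDyer.Rank1Residual.Additive.GordBranchPAdicGrossZagier
import Summits.BirchSwinnertonDyer.Rank1Residual.Additive.QuadraticBranchLower
import Summits.BirchSwinnertonDyer.Rank1Residual.Additive.MinusPeriodRatio
import HarnessLib

/-!
# T-O7 step 2 on the potentially MULTIPLICATIVE locus (M), part 2: the rank-one FACTORISATION
# `QuadraticBranchLowerDivisibilityAt E♭ ∧ BranchPAdicGrossZagierMultAt ⟹ CycLowerBoundAt` and the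
# class forms on `PotMult W p` / X4(M) at every odd `p`
# (cell `b2b-bsdres`, team n1011, seat p01, OWNERS row T-O7; part 1 = `PotMultBranchPAdicGrossZagier.lean`)

HONEST FRAMING (cell `b2b-bsdres`, run/shared/lean/b2b/bsd-rank1-residual/, verbatim in every
file): prove what is provable now; shrink each hard class to its core with data; no claim beyond
stated classes. Research routes; census output = EVIDENCE / conjecture items, never a Literature
fact; RESIDUAL-MAP marks change only by signed lines. §I O7 stays OPEN; X4(M) / X3♯(M) stay
CONSTRUCTION-SHAPED; nothing is booked; no label changes. COVERAGE (stated first, referee 1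
proviso): the potentially multiplicative rows `E = E♭ ⊗ χ_{p*}`, `E♭ = V` MULTIPLICATIVE at the ODD
prime `p` (split: `a_p = 1`, non-split: `a_p = −1`; `p* = (−1)^{(p−1)/2} p`; BOTH parities of
`(p−1)/2`, `p = 3` INCLUDED) — the (M) complement of the defect-2 good-ordinary rows of the two
sibling files; the class corollary is stated on `PotMult W p` / X4(M) at EVERY odd `p` over p16's
`Delbourgo2002.mainTheorem_potMult` (explicit binder A175-(M), `ℓ_p = 1`). NO definition; theorems
only; no Literature fact minted, no `_holds`. The Λ-adic lower input consumed in rank one is p10's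
`E♭`-level conjecture `QuadraticBranchLowerDivisibilityAt V p` (`QuadraticBranchLower.lean`; its (M)
disjuncts), reached from `X(E/ℚ_∞)` by additive-p2's kernel descent
`SelmerDualData.exists_chiEigenInCyclotomic` — p10 flags that for REDUCIBLE `V[p]` (X3 side) that
conjecture is not the intended object; the `PotMult` corollary below is an implication and inherits
that caveat on X3♯(M).

## What

* §2 RANK 1: the FACTORISATION `cycLowerBoundAt_of_quadraticBranchLower_of_branchPAdicGrossZagierMult`
  (`[T¹]fE·log_p γ = (h(0)·u)·q·Reg_p`, using part 1's `B(0) = 0`).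
* §3 class corollaries: `PotMult W p` and X4(M), `r_an = 1`, every odd `p` (`p = 3` included) — the
  twist datum `(V, C, f, B, ϖ)` DISCHARGED.

References: [MazurTateTeitelbaum1986Invent] §I.13–I.14; [Delbourgo1998] §2.5; [Delbourgo2002] Thm. (A),
(B), Example p. 40; [GreenbergLNM1716] §5; [SkinnerUrban2014] Thm. 3.6.4 (shape); [Miller2011LMS] Def. 1.1.
-/

noncomputable section

open scoped Classical MatrixGroups ModularForm NumberField

open CongruenceSubgroup WeierstrassCurve NumberField Literature.NumberTheory.EllipticCurves
  Literature.NumberTheory.EllipticCurves.ModularForms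
  Literature.NumberTheory.EllipticCurves.Rank1Residual
  Literature.NumberTheory.EllipticCurves.Rank1Residual.Typed
  Literature.NumberTheory.EllipticCurves.Delbourgo2002
  Literature.NumberTheory.GaloisRepresentations
  IsDedekindDomain

namespace Summit.BirchSwinnertonDyer.Rank1Residual.Additive

variable (W : WeierstrassCurve ℚ) [W.IsElliptic] [W.IsGloballyMinimal] (p : ℕ) [hp : Fact p.Prime]

/-- **RANK ONE, (M): the FACTORISATION.** Let `W` be globally minimal, additive at the odd prime `p`, of
analytic rank `1`, `V` multiplicative at `p` with `C • V^{(p*)} = W`, `f` its newform, `B`, `ϖ` the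
branch series and period ratio of the parity / sign. Then p10's `E♭`-level Λ-adic conjecture
`QuadraticBranchLowerDivisibilityAt V p` (its (M) disjunct: every `g ∈ char_Λ e_{(p−1)/2}X(E♭/ℚ(μ_{p^∞}))`
is `h·(ϖ·B)`), pulled back to `X(E/ℚ_∞)` by additive-p2's kernel descent
`SelmerDualData.exists_chiEigenInCyclotomic` (same characteristic ideal), and the typed
`BranchPAdicGrossZagierMultAt W p Dh` give p01's `CycLowerBoundAt W p Dh`:
`[T¹]fE·log_p γ = (h(0)·u)·q·Reg_p(Dh)` since `B(0) = 0`. Binders: modularity, GZK.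
[cite: GreenbergLNM1716, §5 (PDF p. 143)] [cite: MazurTateTeitelbaum1986Invent, §I.14]
[cite: SkinnerUrban2014, Thm. 3.6.4 (p. 43) (shape only; nothing asserted)] -/
theorem cycLowerBoundAt_of_quadraticBranchLower_of_branchPAdicGrossZagierMult
    (hmod : hasEntireLFunction_rat) (hGZK : rank_eq_analyticRank_of_analyticRank_le_one)
    (hadd : Addv W p) (hr : W.analyticRank = 1) (hp2 : p ≠ 2)
    (V : WeierstrassCurve ℚ) [V.IsElliptic] [V.IsGloballyMinimal]
    (C : VariableChange ℚ) (hC : C • V.quadraticTwist ((-1 : ℚ) ^ (p / 2) * p) = W)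
    {N : ℕ} [NeZero N] {f : CuspForm (Gamma0 N) 2} (hf : IsNewformOf V f) (B : PowerSeries ℚ_[p])
    (hVB : (V.HasSplitMultiplicativeReductionAtPrime p ∧
        B = if Even (p / 2) then padicLFunctionPlusBranchMult f (1 : ℚ_[p]) (p / 2)
          else padicLFunctionMinusBranchMult f (1 : ℚ_[p]) (p / 2)) ∨
      (V.HasMultiplicativeReductionAtPrime p ∧ ¬ V.HasSplitMultiplicativeReductionAtPrime p ∧
        B = if Even (p / 2) then padicLFunctionPlusBranchMult f (-1 : ℚ_[p]) (p / 2)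
          else padicLFunctionMinusBranchMult f (-1 : ℚ_[p]) (p / 2)))
    (ϖ : ℚ) (hϖ : if Even (p / 2) then (ϖ : ℝ) * V.realPeriodRat = plusPeriod f
      else (ϖ : ℝ) * V.imaginaryPeriodRat = minusPeriod f)
    {Dh : PAdicHeightData W p} (hcV : QuadraticBranchLowerDivisibilityAt V p)
    (hGZ : BranchPAdicGrossZagierMultAt W p Dh) : CycLowerBoundAt W p Dh := by
  intro κ γ hκ hγ hγ' D fE hchar
  have hmw : W.mordellWeilRank = 1 := by rw [(hGZK W (by rw [hr])).1, hr]
  -- descent of `D` to the eigen-datum over `ℚ(μ_{p^∞})` (additive-p2), then p10's conjecture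
  haveI hcycL : IsCyclotomicExtension {p} ℚ (CyclotomicField p ℚ) := by
    have h : (CyclotomicField.algebra p ℚ : Algebra ℚ (CyclotomicField p ℚ)) =
        DivisionRing.toRatAlgebra := Subsingleton.elim _ _
    exact h ▸ CyclotomicField.isCyclotomicExtension p ℚ
  obtain ⟨K, θ, hK2, hθ, hθ2⟩ := exists_intermediateField_sq_eq_pStar p (CyclotomicField p ℚ) hp2
  haveI : NumberField K := NumberField.of_module_finite ℚ K
  haveI : IsGalois ℚ K := isGalois_of_finrank_eq_two K hK2
  haveI := normal_galRange K hK2 (sigmaQ_ne_one K hK2 hθ hθ2)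
  haveI := normal_galRange_cyclotomic p (CyclotomicField p ℚ)
  have hd0 : ((-1 : ℚ) ^ (p / 2) * p) ≠ 0 :=
    mul_ne_zero (pow_ne_zero _ (by norm_num)) (Nat.cast_ne_zero.mpr hp.out.ne_zero)
  haveI : (V.quadraticTwist ((-1 : ℚ) ^ (p / 2) * p)).IsElliptic := V.isElliptic_quadraticTwist hd0
  obtain ⟨γ₁, hγ₁KF, hκγ₁, ⟨g₀, hg₀, hγ₁eq⟩, D', hchar', -⟩ :=
    SelmerDualData.exists_chiEigenInCyclotomic p (CyclotomicField p ℚ) V K hK2 hθ hθ2 κ hC hp2 D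
  have hmem : fE ∈ Literature.NumberTheory.EllipticCurves.Module.charIdeal (IwasawaAlgebra p) D'.X := by
    rw [hchar', hchar]
    exact Ideal.mem_span_singleton_self fE
  obtain ⟨h, hfac⟩ := hcV K (CyclotomicField p ℚ) (κ := κ) (γ := γ₁) (f := f) B hp2 hK2 ⟨θ, hθ2⟩
    (Or.inr hVB) hκ (isTopGenerator_of_kappa_eq κ hκγ₁ hγ)
    (isCyclotomicVariable_of_eq_mul p κ hκ hg₀ hγ₁eq hγ') (Subgroup.mem_inf.mp hγ₁KF).1
    (Subgroup.mem_inf.mp hγ₁KF).2 hf D' ϖ hϖ fE hmem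
  -- the typed `p`-adic Gross–Zagier
  obtain ⟨u, q, hlead, hpgz⟩ := hGZ V B hp2 ⟨C, hC⟩ hVB hf ϖ hϖ
  rw [hmw, pow_one] at hpgz
  -- `B(0) = 0`
  have hB0 : PowerSeries.constantCoeff B = 0 :=
    constantCoeff_multBranch_eq_zero_of_analyticRank_eq_one W p hmod hadd hr hp2 V C hC hf B hVB ϖ hϖ
  -- `[T¹] fE = h(0) · ϖ · [T¹] B`
  have hcoeff : ((PowerSeries.coeff 1 fE : ℤ_[p]) : ℚ_[p]) =
      ((PowerSeries.constantCoeff h : ℤ_[p]) : ℚ_[p]) * (((ϖ : ℚ) : ℚ_[p]) * PowerSeries.coeff 1 B) := by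
    have hϖB0 : PowerSeries.constantCoeff (PowerSeries.C ((ϖ : ℚ) : ℚ_[p]) * B) = 0 := by
      rw [map_mul, hB0, mul_zero]
    rw [← Wuthrich2014.coeff_iwasawaToPowerSeries p fE 1, hfac,
      coeff_one_mul_of_constantCoeff_eq_zero p _ _ hϖB0, constantCoeff_iwasawaToPowerSeries,
      PowerSeries.coeff_C_mul]
  refine ⟨q, PowerSeries.constantCoeff h * (u : ℤ_[p]), hlead, ?_⟩
  rw [hmw, pow_one, hcoeff]
  push_cast
  calc ((PowerSeries.constantCoeff h : ℤ_[p]) : ℚ_[p]) * (((ϖ : ℚ) : ℚ_[p]) * PowerSeries.coeff 1 B) *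
        padicLog p (cyclotomicGenerator p)
      = ((PowerSeries.constantCoeff h : ℤ_[p]) : ℚ_[p]) *
          ((((ϖ : ℚ) : ℚ_[p]) * PowerSeries.coeff 1 B) * padicLog p (cyclotomicGenerator p)) := by ring
    _ = ((PowerSeries.constantCoeff h : ℤ_[p]) : ℚ_[p]) *
          (((u : ℤ_[p]) : ℚ_[p]) * (q : ℚ_[p]) * padicRegulator Dh) := by rw [hpgz]
    _ = ((PowerSeries.constantCoeff h : ℤ_[p]) : ℚ_[p]) * ((u : ℤ_[p]) : ℚ_[p]) * (q : ℚ_[p]) *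
          padicRegulator Dh := by ring

end Summit.BirchSwinnertonDyer.Rank1Residual.Additive

/-! ### §3 Class corollaries: `PotMult W p` and X4(M), `r_an = 1`, every odd `p` -/

namespace Summit.BirchSwinnertonDyer.Rank1Residual.AdditivePotMult

open Additive

variable {W : WeierstrassCurve ℚ} [W.IsElliptic] [W.IsGloballyMinimal] {p : ℕ} [hp : Fact p.Prime]

/-- **(M), `r_an = 1`, ANY odd `p` (incl. `3`): the LOWER half from the TWO typed inputs of the route**
— p10's `E♭`-level Λ-adic conjecture on the quadratic branch for every multiplicative twist model
(`hc`, the binder shape of `QuadraticBranchLowerDescent.lean`) and, for every height datum with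
Delbourgo's (B)-clauses, the Schneider rider (EVIDENCE binder) and `BranchPAdicGrossZagierMultAt W p Dh`
— all other binders PUBLISHED: Delbourgo 2002 (A)+(B) in case (M) (`hDelM`, p16's binder, `ℓ_p = 1`),
modularity (`hmod`, `hmodD`), GZK. The twist datum `(V, C, f, B, ϖ)` is DISCHARGED
(`PotMult.exists_mult_pStar_twist_model`, `hmodD`, `exists_rat_mul_imaginaryPeriodRat_eq_minusPeriod`).
On X3♯(M) (reducible `V[p]`) p10's caveat on `hc` applies. [cite: Delbourgo2002, Theorem (A), (B), Example (p. 40)]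
[cite: Miller2011LMS, Def. 1.1] [cite: GreenbergLNM1716, §5] -/
theorem PotMult.missingLowerBoundAt_rankOne_of_quadraticBranchLower_of_branchPAdicGrossZagierMult
    (hDelM : Delbourgo2002.mainTheorem_potMult) (hmod : hasEntireLFunction_rat)
    (hmodD : nonempty_modularParametrizationData)
    (hGZK : rank_eq_analyticRank_of_analyticRank_le_one) (hpm : PotMult W p) (hp2 : p ≠ 2)
    (hr : W.analyticRank = 1)
    (hc : ∀ (V : WeierstrassCurve ℚ) [V.IsElliptic] [V.IsGloballyMinimal],
      (∃ C : VariableChange ℚ, C • V.quadraticTwist ((-1) ^ (p / 2) * p : ℚ) = W) →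
        QuadraticBranchLowerDivisibilityAt V p)
    (hGZ : ∀ Dh : PAdicHeightData W p, LeadingTermClauses W p Dh →
      SchneiderConjecture Dh ∧ BranchPAdicGrossZagierMultAt W p Dh) :
    MissingLowerBoundAt W p := by
  obtain ⟨V, iV, iVm, C, hV, hC⟩ := hpm.exists_mult_pStar_twist_model hp2
  haveI : NeZero (V.conductorNorm ℤ) := ⟨(V.conductorNorm_pos_holds).ne'⟩
  obtain ⟨Dm⟩ := hmodD V
  -- the branch series of the reduction sign and the period ratio of the parity
  obtain ⟨B, hVB⟩ : ∃ B : PowerSeries ℚ_[p],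
      (V.HasSplitMultiplicativeReductionAtPrime p ∧
          B = if Even (p / 2) then padicLFunctionPlusBranchMult Dm.f (1 : ℚ_[p]) (p / 2)
            else padicLFunctionMinusBranchMult Dm.f (1 : ℚ_[p]) (p / 2)) ∨
        (V.HasMultiplicativeReductionAtPrime p ∧ ¬ V.HasSplitMultiplicativeReductionAtPrime p ∧
          B = if Even (p / 2) then padicLFunctionPlusBranchMult Dm.f (-1 : ℚ_[p]) (p / 2)
            else padicLFunctionMinusBranchMult Dm.f (-1 : ℚ_[p]) (p / 2)) := by
    by_cases hs : V.HasSplitMultiplicativeReductionAtPrime p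
    · exact ⟨_, Or.inl ⟨hs, rfl⟩⟩
    · exact ⟨_, Or.inr ⟨hV, hs, rfl⟩⟩
  obtain ⟨ϖ, hϖ⟩ : ∃ ϖ : ℚ, if Even (p / 2) then (ϖ : ℝ) * V.realPeriodRat = plusPeriod Dm.f
      else (ϖ : ℝ) * V.imaginaryPeriodRat = minusPeriod Dm.f := by
    by_cases he : Even (p / 2)
    · obtain ⟨ϖ, -, hϖ, -⟩ := Dm.exists_rat_mul_realPeriodRat_eq_plusPeriod
      exact ⟨ϖ, by rw [if_pos he]; exact hϖ⟩
    · obtain ⟨ϖ, -, hϖ⟩ := exists_rat_mul_imaginaryPeriodRat_eq_minusPeriod Dm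
      exact ⟨ϖ, by rw [if_neg he]; exact hϖ⟩
  refine hpm.missingLowerBoundAt_rankLeOne_of_cycLowerBound hDelM hGZK hp2 (by rw [hr])
    fun Dh hBcl ↦ ?_
  obtain ⟨hS, hGZDh⟩ := hGZ Dh hBcl
  exact ⟨hS, cycLowerBoundAt_of_quadraticBranchLower_of_branchPAdicGrossZagierMult W p hmod hGZK hpm.1
    hr hp2 V C hC Dm.isNewformOf B hVB ϖ hϖ (hc V ⟨C, hC⟩) hGZDh⟩

/-- **X4(M), `r_an = 1`, ANY odd `p`: the LOWER half from the two typed inputs** (X4(M) stays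
CONSTRUCTION-SHAPED; nothing booked). [cite: Delbourgo2002, Theorem (A), (B) (p. 40)] [cite: Miller2011LMS, Def. 1.1] -/
theorem ClassX4M.missingLowerBoundAt_rankOne_of_quadraticBranchLower_of_branchPAdicGrossZagierMult
    (hDelM : Delbourgo2002.mainTheorem_potMult) (hmod : hasEntireLFunction_rat)
    (hmodD : nonempty_modularParametrizationData)
    (hGZK : rank_eq_analyticRank_of_analyticRank_le_one) (hX : ClassX4M W p) (hr : W.analyticRank = 1)
    (hc : ∀ (V : WeierstrassCurve ℚ) [V.IsElliptic] [V.IsGloballyMinimal],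
      (∃ C : VariableChange ℚ, C • V.quadraticTwist ((-1) ^ (p / 2) * p : ℚ) = W) →
        QuadraticBranchLowerDivisibilityAt V p)
    (hGZ : ∀ Dh : PAdicHeightData W p, LeadingTermClauses W p Dh →
      SchneiderConjecture Dh ∧ BranchPAdicGrossZagierMultAt W p Dh) :
    MissingLowerBoundAt W p :=
  hX.potMult.missingLowerBoundAt_rankOne_of_quadraticBranchLower_of_branchPAdicGrossZagierMult hDelM
    hmod hmodD hGZK hX.p_ne_two hr hc hGZ

end Summit.BirchSwinnertonDyer.Rank1Residual.AdditivePotMult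

end
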